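import Literature.NumberTheory.Automorphic.ArthurClozelFibresOfJacquetShalika
import Literature.NumberTheory.Automorphic.PairLFunctionPolesEqConjLeTwo
import Literature.NumberTheory.Automorphic.CuspidalDescentDetCubicRepData
import Literature.NumberTheory.Automorphic.IdeleClassGroupProofs
import Literature.NumberTheory.Automorphic.IdeleNormDetGL
import Literature.NumberTheory.GaloisRepresentations.HeckeCharacterWeakApproximation
import HarnessLib

/-!
# Arthur–Clozel, Ch. 3, Thm. 3.1 (quadratic case) without Jacquet–Shalika on the boundary line:
# the unitary shift is killed on `GL(1)`

Topic `NumberTheory/Automorphic`; namespace `Literature.NumberTheory.Automorphic`. Proof file (theorems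
only), sibling of `ArthurClozelFibresRepData` / `ArthurClozelFibresOfJacquetShalika` /
`ArthurClozelFibresRankTwo`, which reduce the named fact `ArthurClozel_fibres_quadratic` of
`TunnellLemma` (A–C 1989, Ch. 3, Thm. 3.1 for a quadratic `M/K`, Hecke matrices a.e., Borel–Jacquet
model) to FOUR leaves: Jacquet–Shalika (2.2) at `s = 1`, (2.2′) on `re s = 1`, `s ≠ 1`, (2.3), and
multiplicity one.  There the boundary fact (2.2′) (analytic core: Shahidi's non-vanishing on the whole
line) has exactly ONE job (`ArthurClozel_fibres_of_JacquetShalika_of_shift`): to kill the imaginary shift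
`τ` between the two unitary (`A_G`-trivial) normalisations `t_π = q^{s} t_P`, `t_{π'} = q^{s'} t_{P'}`,
`s' - s = iτ`, of "We may assume `π, π'` unitary".  This file kills `τ` on `GL(1)` instead
(`shift_eq_zero_of_centralCharacters`): determinants of `t_P(w)^{(f)} = (q_w^{iτ} t_{P'}(w))^{(f)}` are
values of central characters (`CuspidalAutomorphicRepGL.exists_centralCharacter`), so the Hecke
characters `ω_P²` and `(ω_{P'} ‖·‖^{-inτ})²` agree at almost every uniformizer, hence are equal
(`HeckeCharacter.ext_of_eventually_valueAtUniformizer_eq`), and on `A_G = ℝ_{>0}` this reads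
`r^{-2in[K:ℚ]τ} = 1` for all `r > 0`, so `τ = 0`.  Consequences:
`ArthurClozel_fibres_quadratic_L2_of_shift_of_character'` (the `L²` dichotomy up to a shift, no (2.2′));
`ArthurClozel_fibres_quadratic_rank_of_three_leaves` (Thm. 3.1 for `GL_n`, `n ≥ 1` fixed, from (2.2) at
`s = 1`, (2.3), multiplicity one at that rank); `ArthurClozel_fibres_quadratic_two_of_gl2_at_one`
(Thm. 3.1 for `GL₂`, Langlands 1980, from (2.2) at `s = 1` and multiplicity one for `GL₂` ONLY — (2.3)₂ is
the theorem `JacquetShalika1981_partialPairL_pole_of_eq_conj_holds_of_le_two`);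
`ArthurClozel_fibres_quadratic_holds_of_three_leaves` (the all-rank named fact from three leaves,
improving `ArthurClozel_fibres_quadratic_holds_of`).

References: J. Arthur, L. Clozel, Ann. of Math. Stud. 120 (1989), Ch. 3 §2 (2.1)–(2.3), Thm. 3.1 and
its proof (p. 201) [ArthurClozelAMS120]; H. Jacquet, J. A. Shalika, Amer. J. Math. 103 (1981), II,
Prop. 3.6 [JacquetShalikaAJM1981II]; Cassels–Fröhlich (1967), Ch. VII §4 Prop. 4.1
[CasselsFrohlichANT1967]; A. Borel, H. Jacquet, Corvallis (1979), §4.6, 5.7 [BorelJacquetCorvallis1979].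
-/

noncomputable section

open scoped MatrixGroups NNReal Classical
open NumberField IsDedekindDomain MeasureTheory Filter

namespace Literature.NumberTheory.Automorphic

open AdelicGroupData
open Literature.NumberTheory.GaloisRepresentations (HeckeCharacter ideleGroup)

section Shift

variable {n : ℕ} {K : Type} [Field K] [NumberField K]
  {μ : Measure (gl n K).automorphicQuotient} [(gl n K).IsAutomorphicMeasure μ]

/-- If `exp (x c) = 1` for every real `x` then `c = 0` (differentiate at `x = 0`). [folklore] -/
theorem eq_zero_of_forall_cexp_ofReal_mul_eq_one {c : ℂ}
    (h : ∀ x : ℝ, Complex.exp ((x : ℂ) * c) = 1) : c = 0 := by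
  have h1 : HasDerivAt (fun y : ℂ => Complex.exp (y * c))
      (Complex.exp ((((0 : ℝ) : ℂ)) * c) * c) (((0 : ℝ) : ℂ)) :=
    (hasDerivAt_mul_const c).cexp
  have h2 : HasDerivAt (fun x : ℝ => Complex.exp ((x : ℂ) * c))
      (Complex.exp ((((0 : ℝ) : ℂ)) * c) * c) 0 := h1.comp_ofReal
  have hfun : (fun x : ℝ => Complex.exp ((x : ℂ) * c)) = fun _ => (1 : ℂ) := funext h
  rw [hfun] at h2
  have h3 : Complex.exp ((((0 : ℝ) : ℂ)) * c) * c = 0 := h2.unique (hasDerivAt_const (0 : ℝ) (1 : ℂ))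
  exact (mul_eq_zero.1 h3).resolve_left (Complex.exp_ne_zero _)

/-- **The unitary shift is killed on `GL(1)`: central characters and strong multiplicity one for
Hecke characters.**  Let `M/K` be quadratic, `π, π'` cuspidal automorphic representations of
`GL_n(𝔸_K)` (`n ≥ 1`; closed irreducible subspaces of `L²_cusp`, trivial on `A_G`) with Satake families
`α, α'` off a finite `S`, and `τ ∈ ℝ` with `α(w)^{f(x|w)} = (q_w^{iτ} α'(w))^{f(x|w)}` for every `w ∉ S`
and every place `x` of `M` above `w`.  Then **`τ = 0`**, without Jacquet–Shalika on `re s = 1`: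
`ω_π(ϖ_w)^{f} = (q_w^{inτ} ω_{π'}(ϖ_w))^{f}` for the central characters
(`CuspidalAutomorphicRepGL.exists_centralCharacter`), `f = f(x|w) ∈ {1, 2}`, so `ω_π²` and
`(ω_{π'} ‖·‖^{-inτ})²` agree at almost every uniformizer, hence are equal
(`HeckeCharacter.ext_of_eventually_valueAtUniformizer_eq`); on `A_G = ℝ_{>0}` this reads
`r^{-2in[K:ℚ]τ} = 1` for all `r > 0`, so `τ = 0`. [folklore] -/
theorem shift_eq_zero_of_centralCharacters (hn : 0 < n)
    {M : Type} [Field M] [NumberField M] [Algebra K M] (hKM : Module.finrank K M = 2)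
    (P P' : CuspidalAutomorphicRepGL n K μ) {S : Set (HeightOneSpectrum (𝓞 K))} (hS : S.Finite)
    {α α' : SatakeFamily K} (hα : IsSatakeFamilyOf P S α) (hα' : IsSatakeFamilyOf P' S α') (τ : ℝ)
    (h : ∀ w ∉ S, ∀ x : HeightOneSpectrum (𝓞 M), x.asIdeal.under (𝓞 K) = w.asIdeal →
      (α w).map (· ^ x.asIdeal.inertiaDeg (𝓞 K)) =
        ((α' w).map (((w.residueCard : ℂ) ^ ((τ : ℂ) * Complex.I)) * ·)).map
          (· ^ x.asIdeal.inertiaDeg (𝓞 K))) :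
    τ = 0 := by
  -- central characters of `π`, `π'`
  obtain ⟨ω, -, hωA, -, -, hωfam⟩ := P.exists_centralCharacter
  obtain ⟨ω', -, hω'A, -, -, hω'fam⟩ := P'.exists_centralCharacter
  have hq : ∀ v : HeightOneSpectrum (𝓞 K), (v.residueCard : ℂ) ≠ 0 := fun v => by
    have := v.one_lt_residueCard
    exact_mod_cast (by omega : v.residueCard ≠ 0)
  -- the norm character `ν = ‖·‖^{-inτ}`, `ν(ϖ_w) = q_w^{inτ}`
  obtain ⟨ν, hν⟩ := exists_heckeCharacter_ideleNorm_cpow K (-((n : ℂ) * ((τ : ℂ) * Complex.I)))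
  have hνw : ∀ w : HeightOneSpectrum (𝓞 K),
      ν.valueAtUniformizer w = ((w.residueCard : ℂ) ^ ((τ : ℂ) * Complex.I)) ^ n := by
    intro w
    rw [HeckeCharacter.valueAtUniformizer_of_cpow hν w, Complex.cpow_neg, inv_inv, Complex.cpow_nat_mul]
  -- `ω² = (ω' ν)²`: the values at the uniformizers agree off `S`
  have hval : ∀ᶠ w : HeightOneSpectrum (𝓞 K) in cofinite,
      (ω ^ 2).valueAtUniformizer w = ((ω' * ν) ^ 2).valueAtUniformizer w := by
    have hSc : ∀ᶠ w : HeightOneSpectrum (𝓞 K) in cofinite, w ∉ S := by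
      rw [Filter.eventually_cofinite]; simpa using hS
    filter_upwards [hSc] with w hw
    obtain ⟨x, hx⟩ := exists_above (E := M) w
    obtain ⟨𝔫', -, -, ϖ', hSat'⟩ := hα' w hw
    have hcard : Multiset.card (α' w) = n := hSat'.card_eq
    have hrel := congrArg Multiset.prod (h w hw x hx)
    rw [prod_map_pow_eq, prod_map_pow_eq, prod_map_const_mul_eq, hcard] at hrel
    -- `a^f = (c^n b)^f` with `f ∈ {1,2}` gives `a² = (c^n b)²`
    have hsq : (α w).prod ^ 2 = (((w.residueCard : ℂ) ^ ((τ : ℂ) * Complex.I)) ^ n * (α' w).prod) ^ 2 := by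
      rcases inertiaDeg_eq_one_or_two_of_finrank_eq_two hKM w x hx with h1 | h2
      · rw [h1, pow_one, pow_one] at hrel; rw [hrel]
      · rwa [h2] at hrel
    have e1 := (hωfam hα w hw).2
    have e2 := (hω'fam hα' w hw).2
    simp only [GaloisRepresentations.HeckeCharacter.valueAtUniformizer,
      GaloisRepresentations.HeckeCharacter.localComponent_apply,
      GaloisRepresentations.HeckeCharacter.mul_apply, GaloisRepresentations.HeckeCharacter.pow_apply,
      Units.val_mul, Units.val_pow_eq_pow_val] at e1 e2 ⊢
    simp only [GaloisRepresentations.HeckeCharacter.valueAtUniformizer,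
      GaloisRepresentations.HeckeCharacter.localComponent_apply] at hνw
    rw [e1, e2, hνw w, hsq]
    ring
  have heq : ω ^ 2 = (ω' * ν) ^ 2 :=
    GaloisRepresentations.HeckeCharacter.ext_of_eventually_valueAtUniformizer_eq hval
  -- evaluate on `A_G`: `1 = (r^{[K:ℚ]})^{-2inτ}` for all `r > 0`
  have hAval : ∀ r : ℝ≥0ˣ,
      (((((r : ℝ≥0) : ℝ) ^ Module.finrank ℚ K : ℝ) : ℂ) ^ (-((n : ℂ) * ((τ : ℂ) * Complex.I)))) ^ 2 = 1 := by
    intro r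
    have e := congrArg (fun η : HeckeCharacter K => ((η (posRealIdele K r) : ℂˣ) : ℂ)) heq
    simp only [GaloisRepresentations.HeckeCharacter.pow_apply, GaloisRepresentations.HeckeCharacter.mul_apply,
      hωA r, hω'A r, one_pow, one_mul, Units.val_pow_eq_pow_val, Units.val_one] at e
    rw [hν, ← coe_ideleNorm, ideleNorm_posRealIdele_holds K r, NNReal.coe_pow] at e
    exact e.symm
  have hexp : ∀ x : ℝ, Complex.exp ((x : ℂ) * (2 * -((n : ℂ) * ((τ : ℂ) * Complex.I)))) = 1 := by
    intro x
    have hpos : 0 < Real.exp (x / Module.finrank ℚ K) := Real.exp_pos _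
    let r : ℝ≥0ˣ := Units.mk0 ⟨Real.exp (x / Module.finrank ℚ K), hpos.le⟩
      (by rw [Ne, ← NNReal.coe_eq_zero]; exact hpos.ne')
    have e := hAval r
    have hrx : ((((r : ℝ≥0) : ℝ) ^ Module.finrank ℚ K : ℝ)) = Real.exp x := by
      change (Real.exp (x / Module.finrank ℚ K)) ^ Module.finrank ℚ K = Real.exp x
      rw [← Real.exp_nat_mul]
      congr 1
      have hd : ((Module.finrank ℚ K : ℕ) : ℝ) ≠ 0 := by exact_mod_cast Module.finrank_pos.ne'
      field_simp
    rw [hrx, Complex.ofReal_exp, Complex.cpow_def_of_ne_zero (Complex.exp_ne_zero _),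
      Complex.log_exp (by rw [Complex.ofReal_im]; linarith [Real.pi_pos])
        (by rw [Complex.ofReal_im]; exact Real.pi_pos.le), ← Complex.exp_nat_mul] at e
    rw [← e]
    congr 1
    push_cast
    ring
  have hw0 : (2 : ℂ) * -((n : ℂ) * ((τ : ℂ) * Complex.I)) = 0 := eq_zero_of_forall_cexp_ofReal_mul_eq_one hexp
  have hn0 : (n : ℂ) ≠ 0 := Nat.cast_ne_zero.2 hn.ne'
  have : (τ : ℂ) = 0 := by
    have h2 : (2 : ℂ) ≠ 0 := two_ne_zero
    have := hw0
    simp only [mul_eq_zero, neg_eq_zero, h2, hn0, Complex.I_ne_zero, false_or, or_false] at this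
    exact this
  exact_mod_cast this

/-- **Arthur–Clozel, Ch. 3, Thm. 3.1 for a quadratic extension, up to a unitary shift, given the
quadratic character (`L²` model) — from (2.1), (2.2) at `s = 1`, (2.3) and multiplicity one, WITHOUT
(2.2′).**  Same statement as `ArthurClozel_fibres_quadratic_L2_of_shift_of_character`, minus the
hypothesis `JacquetShalika1981_partialPairL_boundary_of_ne_one`: the shift vanishes by
`shift_eq_zero_of_centralCharacters`, after which the unshifted `L²` theorem
(`ArthurClozel_fibres_satake_of_JacquetShalika` with `l = 2` and the data of `exists_quadratic_setup`)
gives, off a finite `T ⊇ S`, either `α' = α` or `α'(w) = ε_{M/K}(w) α(w)`.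
[cite: ArthurClozelAMS120, Ch. 3, Thm. 3.1 and its proof (p. 201)] -/
theorem ArthurClozel_fibres_quadratic_L2_of_shift_of_character' (hn : 0 < n)
    (h21 : JacquetShalika1981_multipliable_partialPairL (n := n) (m := n) (K := K) (μ := μ) (μ' := μ))
    (h22 : JacquetShalika1981_partialPairL_at_one_of_ne_conj (n := n) (K := K) (μ := μ))
    (h23 : JacquetShalika1981_partialPairL_pole_of_eq_conj (n := n) (K := K) (μ := μ))
    (hm1 : multiplicity_one_gl n K μ)
    {M : Type} [Field M] [NumberField M] [Algebra K M] (hKM : Module.finrank K M = 2)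
    (ω : HeckeCharacter K) (hωfin : ω.IsFiniteOrder)
    (hωM : ∀ᶠ w : HeightOneSpectrum (𝓞 K) in cofinite, ω.valueAtUniformizer w = quadraticSign M w)
    (P P' : CuspidalAutomorphicRepGL n K μ) {S : Set (HeightOneSpectrum (𝓞 K))} (hS : S.Finite)
    {α α' : SatakeFamily K} (hα : IsSatakeFamilyOf P S α) (hα' : IsSatakeFamilyOf P' S α') (τ : ℝ)
    (h : ∀ w ∉ S, ∀ x : HeightOneSpectrum (𝓞 M), x.asIdeal.under (𝓞 K) = w.asIdeal →
      (α w).map (· ^ x.asIdeal.inertiaDeg (𝓞 K)) =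
        ((α' w).map (((w.residueCard : ℂ) ^ ((τ : ℂ) * Complex.I)) * ·)).map
          (· ^ x.asIdeal.inertiaDeg (𝓞 K))) :
    τ = 0 ∧ ∃ T : Set (HeightOneSpectrum (𝓞 K)), T.Finite ∧ S ⊆ T ∧
      ((∀ w ∉ T, α' w = α w) ∨ (∀ w ∉ T, α' w = (α w).map (quadraticSign M w * ·))) := by
  have hτ : τ = 0 := shift_eq_zero_of_centralCharacters hn hKM P P' hS hα hα' τ h
  subst hτ
  -- the relation is unshifted: `q^{0} = 1`
  have h0 : ∀ w ∉ S, ∀ x : HeightOneSpectrum (𝓞 M), x.asIdeal.under (𝓞 K) = w.asIdeal →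
      (α w).map (· ^ x.asIdeal.inertiaDeg (𝓞 K)) = (α' w).map (· ^ x.asIdeal.inertiaDeg (𝓞 K)) := by
    intro w hw x hx
    have := h w hw x hx
    rwa [Complex.ofReal_zero, zero_mul, Complex.cpow_zero, map_one_mul] at this
  obtain ⟨𝔪, h𝔪, hω𝔪⟩ :=
    Literature.NumberTheory.GaloisRepresentations.HeckeCharacter.exists_level_of_isFiniteOrder n hωfin
  obtain ⟨T, f, g, hTfin, hST, hT𝔪, hTω, hfg, hζ, h', -⟩ := exists_quadratic_setup hKM hωM h𝔪 hS h0
  obtain ⟨i, hi, he⟩ := ArthurClozel_fibres_satake_of_JacquetShalika hn h21 h22 h23 hm1 hωfin h𝔪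
    hω𝔪 hTfin hT𝔪 two_pos f g hfg hζ P P' (hα.mono hST) (hα'.mono hST) h'
  refine ⟨rfl, T, hTfin, hST, ?_⟩
  interval_cases i
  · left
    intro w hw
    rw [he w hw, pow_zero, map_one_mul]
  · right
    intro w hw
    rw [he w hw, pow_one, hTω w hw]

end Shift

/-! ### Thm. 3.1 for Borel–Jacquet data from three leaves -/

section Leaves

/-- **Arthur–Clozel, Ch. 3, Thm. 3.1 (quadratic case, Borel–Jacquet data) at a FIXED rank `n ≥ 1`
from THREE leaves at that rank**: Jacquet–Shalika (2.2) at `s = 1` (`h22`), (2.3) (`h23`) and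
multiplicity one on `L²_cusp(GL_n)` (`hm1`) — no boundary-line fact (2.2′).  For a quadratic extension
`M/K` and cuspidal automorphic representations `π, π'` of `GL_n(𝔸_K)` (arbitrary central characters)
with `t_{π,w}^{f(x|w)} = t_{π',w}^{f(x|w)}` for almost all places `x` of `M`, either `t_{π'} = t_π`
almost everywhere or `t_{π',w} = ε_{M/K}(w) t_{π,w}` almost everywhere.  Proof: the body of
`ArthurClozel_fibres_quadratic_rank_of_leaves` (`ArthurClozelFibresRankTwo`) with the `L²` engine
`ArthurClozel_fibres_quadratic_L2_of_shift_of_character'` (shift killed on `GL(1)`).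
[cite: ArthurClozelAMS120, Ch. 3, Thm. 3.1 and its proof (p. 201)] -/
theorem ArthurClozel_fibres_quadratic_rank_of_three_leaves {n : ℕ} (hn : 0 < n)
    (h22 : ∀ {K : Type} [Field K] [NumberField K] {μ : Measure (gl n K).automorphicQuotient}
      [(gl n K).IsAutomorphicMeasure μ],
      JacquetShalika1981_partialPairL_at_one_of_ne_conj (n := n) (K := K) (μ := μ))
    (h23 : ∀ {K : Type} [Field K] [NumberField K] {μ : Measure (gl n K).automorphicQuotient}
      [(gl n K).IsAutomorphicMeasure μ],
      JacquetShalika1981_partialPairL_pole_of_eq_conj (n := n) (K := K) (μ := μ))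
    (hm1 : ∀ (K : Type) [Field K] [NumberField K] (μ : Measure (gl n K).automorphicQuotient)
      [(gl n K).IsAutomorphicMeasure μ], multiplicity_one_gl n K μ)
    (K M : Type) [Field K] [NumberField K] [Field M] [NumberField M] [Algebra K M]
    (hKM : Module.finrank K M = 2) (hK : isCompact_glFiniteIntegralLevel n K)
    (π π' : CuspidalAutomorphicRepData n K hK)
    (hyp : ∀ᶠ x : HeightOneSpectrum (𝓞 M) in Filter.cofinite,
      ∀ (w : HeightOneSpectrum (𝓞 K)) (α α' : Multiset ℂ), x.asIdeal.under (𝓞 K) = w.asIdeal →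
        π.1.HasSatakeParamAt w α → π'.1.HasSatakeParamAt w α' →
          α.map (· ^ x.asIdeal.inertiaDeg (𝓞 K)) = α'.map (· ^ x.asIdeal.inertiaDeg (𝓞 K))) :
    (∀ᶠ w : HeightOneSpectrum (𝓞 K) in Filter.cofinite, ∀ α : Multiset ℂ,
        π.1.HasSatakeParamAt w α → π'.1.HasSatakeParamAt w α) ∨
    (∀ᶠ w : HeightOneSpectrum (𝓞 K) in Filter.cofinite, ∀ α : Multiset ℂ,
        π.1.HasSatakeParamAt w α → π'.1.HasSatakeParamAt w (α.map (quadraticSign M w * ·))) := by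
  haveI : NeZero n := ⟨hn.ne'⟩
  obtain ⟨μm, hμm⟩ := AdelicGroupData.exists_isAutomorphicMeasure_gl_holds n K
  haveI := hμm
  -- unitary normalisations of `π` and `π'`
  obtain ⟨s, P, S, αP, hS, hαP, hiff⟩ :=
    CuspidalAutomorphicRepData.exists_satake_eq_cpow_mul_L2_unconditional hK μm π
  obtain ⟨s', P', S', αP', hS', hαP', hiff'⟩ :=
    CuspidalAutomorphicRepData.exists_satake_eq_cpow_mul_L2_unconditional hK μm π'
  -- the exceptional places
  set E : Set (HeightOneSpectrum (𝓞 M)) := {x | ¬ ∀ (w : HeightOneSpectrum (𝓞 K)) (α α' : Multiset ℂ),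
      x.asIdeal.under (𝓞 K) = w.asIdeal → π.1.HasSatakeParamAt w α → π'.1.HasSatakeParamAt w α' →
        α.map (· ^ x.asIdeal.inertiaDeg (𝓞 K)) = α'.map (· ^ x.asIdeal.inertiaDeg (𝓞 K))} with hE
  have hEfin : E.Finite := Filter.eventually_cofinite.1 hyp
  set T : Set (HeightOneSpectrum (𝓞 K)) := S ∪ S' ∪ ((fun x : HeightOneSpectrum (𝓞 M) => x.under (𝓞 K)) '' E)
    with hT
  have hTfin : T.Finite := (hS.union hS').union (hEfin.image _)
  have hST : S ⊆ T := fun w hw => Or.inl (Or.inl hw)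
  have hS'T : S' ⊆ T := fun w hw => Or.inl (Or.inr hw)
  -- the shifted relation `α_P(w)^{(f)} = (q^{s'-s} α_{P'}(w))^{(f)}` for all `x ∣ w ∉ T`
  have hrel0 : ∀ w ∉ T, ∀ x : HeightOneSpectrum (𝓞 M), x.asIdeal.under (𝓞 K) = w.asIdeal →
      (αP w).map (· ^ x.asIdeal.inertiaDeg (𝓞 K)) =
        ((αP' w).map (((w.residueCard : ℂ) ^ (s' - s)) * ·)).map (· ^ x.asIdeal.inertiaDeg (𝓞 K)) := by
    intro w hw x hx
    have hxE : x ∉ E := fun hxE => hw (Or.inr ⟨x, hxE, HeightOneSpectrum.ext hx⟩)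
    simp only [hE, Set.mem_setOf_eq, not_not] at hxE
    have hq : (w.residueCard : ℂ) ≠ 0 := by
      have := w.one_lt_residueCard; exact_mod_cast (by omega : w.residueCard ≠ 0)
    have h := hxE w _ _ hx ((hiff w (fun h => hw (hST h)) _).2 rfl) ((hiff' w (fun h => hw (hS'T h)) _).2 rfl)
    have hcne : (w.residueCard : ℂ) ^ s ≠ 0 := fun h0 => hq ((Complex.cpow_eq_zero_iff _ _).1 h0).1
    have h' := map_pow_eq_map_div_map_pow hcne _ h
    rwa [← Complex.cpow_sub _ _ hq] at h'
  -- if every place is exceptional there is nothing to prove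
  by_cases hex : ∃ w₀, w₀ ∉ T
  swap
  · simp only [not_exists, not_not] at hex
    left
    exact Filter.eventually_cofinite.2 (hTfin.subset fun w _ => hex w)
  -- `re s = re s'`: unitarity of the central characters of `P`, `P'` at one place
  obtain ⟨w₀, hw₀⟩ := hex
  obtain ⟨x₀, hx₀⟩ := exists_above (E := M) w₀
  have hre : (s' - s).re = 0 := by
    have hrel := hrel0 w₀ hw₀ x₀ hx₀
    obtain ⟨𝔫, -, -, ϖ, hSat⟩ := hαP w₀ (fun h => hw₀ (hST h))
    obtain ⟨𝔫', -, -, ϖ', hSat'⟩ := hαP' w₀ (fun h => hw₀ (hS'T h))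
    have hf : 0 < x₀.asIdeal.inertiaDeg (𝓞 K) := by
      rcases inertiaDeg_eq_one_or_two_of_finrank_eq_two hKM w₀ x₀ hx₀ with h | h <;> omega
    refine re_eq_zero_of_map_pow_eq_shift w₀.one_lt_residueCard hf ?_ hSat.norm_prod_eq_one
      hSat'.norm_prod_eq_one hrel
    rw [hSat'.card_eq]; exact NeZero.ne n
  set τ : ℝ := (s' - s).im with hτ
  have hsτ : s' - s = (τ : ℂ) * Complex.I := by
    apply Complex.ext
    · simp [hre]
    · simp [hτ]
  -- the `L²` theorem up to the unitary shift `q^{iτ}`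
  have hrel : ∀ w ∉ T, ∀ x : HeightOneSpectrum (𝓞 M), x.asIdeal.under (𝓞 K) = w.asIdeal →
      (αP w).map (· ^ x.asIdeal.inertiaDeg (𝓞 K)) =
        ((αP' w).map (((w.residueCard : ℂ) ^ ((τ : ℂ) * Complex.I)) * ·)).map
          (· ^ x.asIdeal.inertiaDeg (𝓞 K)) := by
    intro w hw x hx; rw [← hsτ]; exact hrel0 w hw x hx
  obtain ⟨ω, hωfin, hωM⟩ : ∃ ω : HeckeCharacter K, ω.IsFiniteOrder ∧
      ∀ᶠ w : HeightOneSpectrum (𝓞 K) in cofinite, ω.valueAtUniformizer w = quadraticSign M w := by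
    obtain ⟨ω, hωfin, hω⟩ := exists_heckeCharacter_quadraticSign_of_finrank_eq_two hKM
    exact ⟨ω, hωfin, hω.mono fun w hw => hw.2⟩
  obtain ⟨hτ0, T', hT'fin, hTT', hdich⟩ := ArthurClozel_fibres_quadratic_L2_of_shift_of_character' hn
    JacquetShalika1981_multipliable_partialPairL_holds h22 h23 (hm1 K μm) hKM ω hωfin hωM P P'
    hTfin (hαP.mono hST) (hαP'.mono hS'T) τ hrel
  -- hence `s' = s`
  have hss : s' = s := by
    have : s' - s = 0 := by rw [hsτ, hτ0, Complex.ofReal_zero, zero_mul]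
    exact sub_eq_zero.1 this
  have hnotT' : ∀ᶠ w : HeightOneSpectrum (𝓞 K) in cofinite, w ∉ T' := by
    rw [Filter.eventually_cofinite]
    simpa using hT'fin
  -- transport back to the Borel–Jacquet data
  rcases hdich with hA' | hB'
  · left
    filter_upwards [hnotT'] with w hw β hβ
    have hwS : w ∉ S := fun h => hw (hTT' (hST h))
    have hwS' : w ∉ S' := fun h => hw (hTT' (hS'T h))
    rw [(hiff w hwS β).1 hβ]
    exact (hiff' w hwS' _).2 (by rw [hA' w hw, hss])
  · right
    filter_upwards [hnotT'] with w hw β hβ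
    have hwS : w ∉ S := fun h => hw (hTT' (hST h))
    have hwS' : w ∉ S' := fun h => hw (hTT' (hS'T h))
    rw [(hiff w hwS β).1 hβ]
    refine (hiff' w hwS' _).2 ?_
    rw [hB' w hw, hss, Multiset.map_map, Multiset.map_map]
    exact Multiset.map_congr rfl fun a _ => by simp only [Function.comp_apply]; ring

/-- **Arthur–Clozel, Ch. 3, Thm. 3.1 for `GL₂` (fibres of quadratic base change; Langlands 1980) from
Jacquet–Shalika (2.2) at `s = 1` and multiplicity one for `GL₂` ONLY.**  The `n := 2` slice of the
named fact `ArthurClozel_fibres_quadratic`, from the two `GL₂` leaves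
`JacquetShalika1981_partialPairL_at_one_of_ne_conj` (rank 2) and `multiplicity_one_gl 2`: the pole
(2.3) at rank 2 is the tree's theorem `JacquetShalika1981_partialPairL_pole_of_eq_conj_holds_of_le_two`
(Kirillov first moment) and the boundary fact (2.2′) is not needed (`shift_eq_zero_of_centralCharacters`).
[cite: ArthurClozelAMS120, Ch. 3, Thm. 3.1] -/
theorem ArthurClozel_fibres_quadratic_two_of_gl2_at_one
    (h22 : ∀ {K : Type} [Field K] [NumberField K] {μ : Measure (gl 2 K).automorphicQuotient}
      [(gl 2 K).IsAutomorphicMeasure μ],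
      JacquetShalika1981_partialPairL_at_one_of_ne_conj (n := 2) (K := K) (μ := μ))
    (hm1 : ∀ (K : Type) [Field K] [NumberField K] (μ : Measure (gl 2 K).automorphicQuotient)
      [(gl 2 K).IsAutomorphicMeasure μ], multiplicity_one_gl 2 K μ)
    (K M : Type) [Field K] [NumberField K] [Field M] [NumberField M] [Algebra K M]
    (hKM : Module.finrank K M = 2) (hK : isCompact_glFiniteIntegralLevel 2 K)
    (π π' : CuspidalAutomorphicRepData 2 K hK)
    (hyp : ∀ᶠ x : HeightOneSpectrum (𝓞 M) in Filter.cofinite,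
      ∀ (w : HeightOneSpectrum (𝓞 K)) (α α' : Multiset ℂ), x.asIdeal.under (𝓞 K) = w.asIdeal →
        π.1.HasSatakeParamAt w α → π'.1.HasSatakeParamAt w α' →
          α.map (· ^ x.asIdeal.inertiaDeg (𝓞 K)) = α'.map (· ^ x.asIdeal.inertiaDeg (𝓞 K))) :
    (∀ᶠ w : HeightOneSpectrum (𝓞 K) in Filter.cofinite, ∀ α : Multiset ℂ,
        π.1.HasSatakeParamAt w α → π'.1.HasSatakeParamAt w α) ∨
    (∀ᶠ w : HeightOneSpectrum (𝓞 K) in Filter.cofinite, ∀ α : Multiset ℂ,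
        π.1.HasSatakeParamAt w α → π'.1.HasSatakeParamAt w (α.map (quadraticSign M w * ·))) :=
  ArthurClozel_fibres_quadratic_rank_of_three_leaves two_pos h22
    (fun {_} _ _ {_} _ => JacquetShalika1981_partialPairL_pole_of_eq_conj_holds_of_le_two le_rfl)
    hm1 K M hKM hK π π' hyp

/-- **The named fact `ArthurClozel_fibres_quadratic` from THREE all-rank leaves** — Jacquet–Shalika
(2.2) at `s = 1`, (2.3) and multiplicity one for all `GL_n` over all number fields —, improving the
four-leaf decomposition `ArthurClozel_fibres_quadratic_holds_of` (`ArthurClozelFibresOfJacquetShalika`)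
by the boundary-line fact (2.2′) `JacquetShalika1981_partialPairL_boundary_of_ne_one`, which the `GL(1)`
argument `shift_eq_zero_of_centralCharacters` makes redundant; rank `0` is immediate (empty Satake
parameters). [cite: ArthurClozelAMS120, Ch. 3, Thm. 3.1 and its proof (p. 201)] -/
theorem ArthurClozel_fibres_quadratic_holds_of_three_leaves
    (h22 : ∀ {n : ℕ} {K : Type} [Field K] [NumberField K] {μ : Measure (gl n K).automorphicQuotient}
      [(gl n K).IsAutomorphicMeasure μ],
      JacquetShalika1981_partialPairL_at_one_of_ne_conj (n := n) (K := K) (μ := μ))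
    (h23 : ∀ {n : ℕ} {K : Type} [Field K] [NumberField K] {μ : Measure (gl n K).automorphicQuotient}
      [(gl n K).IsAutomorphicMeasure μ],
      JacquetShalika1981_partialPairL_pole_of_eq_conj (n := n) (K := K) (μ := μ))
    (hm1 : ∀ (n : ℕ) (K : Type) [Field K] [NumberField K] (μ : Measure (gl n K).automorphicQuotient)
      [(gl n K).IsAutomorphicMeasure μ], multiplicity_one_gl n K μ) :
    ArthurClozel_fibres_quadratic := by
  intro n K M _ _ _ _ _ hKM hK π π' hyp
  rcases Nat.eq_zero_or_pos n with hn0 | hn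
  · -- `GL_0`: all Satake parameters are the empty multiset
    subst hn0
    left
    filter_upwards [AutomorphicRepData.hasSatakeParamAt_cofinite_holds π'.1] with w hw α hα
    obtain ⟨α', hα'⟩ := hw
    have h1 : α = 0 := Multiset.card_eq_zero.1 hα.card_eq
    have h2 : α' = 0 := Multiset.card_eq_zero.1 hα'.card_eq
    rw [h1, ← h2]
    exact hα'
  · exact ArthurClozel_fibres_quadratic_rank_of_three_leaves hn h22 h23 (hm1 n) K M hKM hK π π' hyp

end Leaves

end Literature.NumberTheory.Automorphic

end
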